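import Literature.MathematicalPhysics.QuantumLattice.OctahedralTiltHoppingAnisotropy
import Mathlib.LinearAlgebra.Matrix.Notation

/-!
# The Slater–Koster two-centre table for `s`, `p`, `d` orbitals, the straight-bond `CuO₂`/`NiO₂`
# dictionary (`t_pd = (√3/2)V_pdσ`, `t_pp = ½(V_ppσ − V_ppπ)`, the `1/√3` rule of `d_{3z²−r²}`), the
# `p`-shell closure identities, and the BUCKLED metal–oxygen–metal bridge in two frame conventions

Every tight-binding fit, Wannier projection or downfolding of a cuprate/nickelate plane is reported in
the vocabulary of Slater and Koster's two-centre integrals: the matrix element between an orbital on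
one atom and an orbital on a second atom at `d = [l, m, n]·|d|` is a fixed polynomial in the
direction cosines `(l, m, n)` times the bond integrals `V_{ll'm}` (`V_spσ, V_ppσ, V_ppπ, V_pdσ, V_pdπ,
V_ddσ, V_ddπ, V_ddδ`) [SlaterKoster1954, Table I], reprinted as [Harrison1999, Table 15-2].  This file
types the table rows a `CuO₂`/`NiO₂` layer uses (§1), PROVES the internal consistency of the
transcription (§2: through a complete `p` shell the `p–d` rows compose EXACTLY into the `d–d` rows
with `V_ddσ ↦ V_pdσ²`, `V_ddπ ↦ V_pdπ²`, `V_ddδ ↦ 0`, which needs `l² + m² + n² = 1`), and derives the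
exact special cases box writers quote:

* §3 straight bonds: along `±x̂` the `d_{x²−y²}`–`p_x` element is `±(√3/2)V_pdσ` with NO `π`
  admixture, along `±ŷ` the `d_{x²−y²}`–`p_y` element is `∓(√3/2)V_pdσ` (the `d`-wave sign pattern of
  the three-band model), `d_{3z²−r²}` couples to the same four oxygens with `∓½V_pdσ` (`s`-wave
  pattern, magnitude ratio `1/√3`), the apical `p_z` couples to `d_{3z²−r²}` with `V_pdσ` and to
  `d_{x²−y²}` NOT AT ALL; `4 t_pd² = 3 V_pdσ²` is the «3» of Harrison's `CuO₂` band
  `ε_k = ε_d − V_pdσ √(3(sin²k_x d + sin²k_y d))` [Harrison1999, §18-4 Eq. (18-19)]; two oxygen `p`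
  orbitals at right angles on a 45° O–O contact couple by `½(V_ppσ − V_ppπ)` in magnitude.
* §4 the buckled planar bridge M–O–M (oxygen lifted so that each M→O direction makes the angle `φ`
  with the plane; M–O–M angle `θ = π − 2φ`) in the LOCAL-FRAME convention (each `d_{x²−y²}`
  quantised in its own tilted octahedron, rigid M–O distance, `σ`-only second-order path through the
  degenerate O `p` shell): the ratio `t(φ)/t(0)` is the `p`-orbital overlap `|ê₁·ê₂| = |cos θ|`, i.e.
  EXACTLY Normand–Kampf's `|cos(π − 2Φ)|` [NormandKampf2001, Eq. (1)] (their «approximately», typed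
  as `lttHoppingFactor` in `OctahedralTiltHoppingAnisotropy.lean`), with `V_pdπ` absent identically.
* §5 the same bridge in the GLOBAL-FRAME convention (`d` orbitals pinned to the crystal axes): the
  closed form `−[¾c⁴(c²−s²)V_σ² + 2√3 c⁴s² V_σV_π − c²s²(c²−s²)V_π²]` (`c = cos φ`, `s = sin φ`), the
  `σ`-only factor `cos⁴φ · cos 2φ = cos⁴φ × (local factor)`, its anisotropy
  `1 − cos⁴φ cos 2φ = 2ε − (5/4)ε² + ¼ε³` in terms of the local one `ε = 2 sin²φ`, hence between `2ε −
  (5/4)ε²` and `2ε`; at `Φ = 5°` it is `∈ (0.0299, 0.0306)` against the local `(0.0151, 0.0153)`; with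
  `V_pdπ/V_pdσ = r ≤ 0` (the physical sign [Harrison1999, §18-4: «V_pdπ is positive», `V_pdσ < 0`])
  the factor is lowered further.  The two conventions are REPORTED side by side as a construction
  lever (`local ≥ global-σ ≥ global-σπ` as factors); nothing here says which describes a material —
  first-principles `t, J` «deviate rather strongly from the elementary orbital-overlap theory»
  [NormandKampf2001, p. 2].
* §6 the apical (inter-layer) `d_{3z²−r²}`–`p`–`d_{3z²−r²}` bridge bent by `φ` (bilayer nickelates,
  M–O_ap–M angle `π − 2φ`): local factor again `|cos θ|`; global `σ`-only factor
  `cos 2φ · (cos²φ − ½ sin²φ)²`.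

Everything is PROVED (polynomial identities, `linear_combination` certificates generated and checked
exactly); no facts, no `sorry`.  NOT here: distance laws `V ∝ d^{−η}` (see
`SuperexchangePressureExponents.lean`), `d–d` rows other than the `e_g` block and `xy`, `f` orbitals,
three-centre terms, non-orthogonality corrections, any number about a material.

References: J. C. Slater, G. F. Koster, Phys. Rev. 94 (1954) 1498, Table I; W. A. Harrison,
*Elementary Electronic Structure* (World Scientific 1999), Table 15-2 (held text p0540) and §18-4
Eqs. (18-18)–(18-19) (held text p0690–0691); B. Normand, A. P. Kampf, Phys. Rev. B 64 (2001) 024521,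
Eq. (1) and p. 2.  AI-produced formalisation (H21, cell hubbard-downfold, seat lit-1, 2026-08-27).
-/

noncomputable section

namespace Literature.MathematicalPhysics.QuantumLattice

namespace SlaterKoster

open Real Matrix

/-! ## 1. The table rows (direction cosines `l, m, n` of the vector from the first to the second orbital) -/

/-- `E_{s,x} = l V_spσ`. [cite: SlaterKoster1954, Table I] -/
def sX (l Vspσ : ℝ) : ℝ := l * Vspσ

/-- `E_{x,x} = l² V_ppσ + (1 − l²) V_ppπ`. [cite: SlaterKoster1954, Table I] -/
def xX (l Vσ Vπ : ℝ) : ℝ := l ^ 2 * Vσ + (1 - l ^ 2) * Vπ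

/-- `E_{x,y} = lm V_ppσ − lm V_ppπ`. [cite: SlaterKoster1954, Table I] -/
def xY (l m Vσ Vπ : ℝ) : ℝ := l * m * Vσ - l * m * Vπ

/-- `E_{x,z} = ln V_ppσ − ln V_ppπ`. [cite: SlaterKoster1954, Table I] -/
def xZ (l n Vσ Vπ : ℝ) : ℝ := l * n * Vσ - l * n * Vπ

/-- `E_{s,x²−y²} = (√3/2)(l² − m²) V_sdσ` — also the `σ`-amplitude of a `d_{x²−y²}` orbital along
`(l,m,n)` (take `V = 1`). [cite: SlaterKoster1954, Table I] -/
def sX2Y2 (l m V : ℝ) : ℝ := √3 / 2 * (l ^ 2 - m ^ 2) * V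

/-- `E_{s,3z²−r²} = [n² − ½(l² + m²)] V_sdσ` — also the `σ`-amplitude of `d_{3z²−r²}` along `(l,m,n)`.
[cite: SlaterKoster1954, Table I] -/
def sZ2 (l m n V : ℝ) : ℝ := (n ^ 2 - (l ^ 2 + m ^ 2) / 2) * V

/-- `E_{x,xy} = √3 l²m V_pdσ + m(1 − 2l²) V_pdπ`. [cite: SlaterKoster1954, Table I] -/
def xXY (l m Vσ Vπ : ℝ) : ℝ := √3 * l ^ 2 * m * Vσ + m * (1 - 2 * l ^ 2) * Vπ

/-- `E_{x,yz} = √3 lmn V_pdσ − 2lmn V_pdπ` (`= E_{z,xy} = E_{y,zx}` by permutation).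
[cite: SlaterKoster1954, Table I] -/
def xYZ (l m n Vσ Vπ : ℝ) : ℝ := √3 * l * m * n * Vσ - 2 * l * m * n * Vπ

/-- `E_{x,zx} = √3 l²n V_pdσ + n(1 − 2l²) V_pdπ`. [cite: SlaterKoster1954, Table I] -/
def xZX (l n Vσ Vπ : ℝ) : ℝ := √3 * l ^ 2 * n * Vσ + n * (1 - 2 * l ^ 2) * Vπ

/-- `E_{x,x²−y²} = (√3/2) l(l² − m²) V_pdσ + l(1 − l² + m²) V_pdπ`. [cite: SlaterKoster1954, Table I] -/
def xX2Y2 (l m Vσ Vπ : ℝ) : ℝ := √3 / 2 * l * (l ^ 2 - m ^ 2) * Vσ + l * (1 - l ^ 2 + m ^ 2) * Vπ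

/-- `E_{y,x²−y²} = (√3/2) m(l² − m²) V_pdσ − m(1 + l² − m²) V_pdπ`. [cite: SlaterKoster1954, Table I] -/
def yX2Y2 (l m Vσ Vπ : ℝ) : ℝ := √3 / 2 * m * (l ^ 2 - m ^ 2) * Vσ - m * (1 + l ^ 2 - m ^ 2) * Vπ

/-- `E_{z,x²−y²} = (√3/2) n(l² − m²) V_pdσ − n(l² − m²) V_pdπ`. [cite: SlaterKoster1954, Table I] -/
def zX2Y2 (l m n Vσ Vπ : ℝ) : ℝ := √3 / 2 * n * (l ^ 2 - m ^ 2) * Vσ - n * (l ^ 2 - m ^ 2) * Vπ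

/-- `E_{x,3z²−r²} = l[n² − ½(l² + m²)] V_pdσ − √3 l n² V_pdπ`. [cite: SlaterKoster1954, Table I] -/
def xZ2 (l m n Vσ Vπ : ℝ) : ℝ := l * (n ^ 2 - (l ^ 2 + m ^ 2) / 2) * Vσ - √3 * l * n ^ 2 * Vπ

/-- `E_{y,3z²−r²} = m[n² − ½(l² + m²)] V_pdσ − √3 m n² V_pdπ`. [cite: SlaterKoster1954, Table I] -/
def yZ2 (l m n Vσ Vπ : ℝ) : ℝ := m * (n ^ 2 - (l ^ 2 + m ^ 2) / 2) * Vσ - √3 * m * n ^ 2 * Vπ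

/-- `E_{z,3z²−r²} = n[n² − ½(l² + m²)] V_pdσ + √3 n(l² + m²) V_pdπ`. [cite: SlaterKoster1954, Table I] -/
def zZ2 (l m n Vσ Vπ : ℝ) : ℝ := n * (n ^ 2 - (l ^ 2 + m ^ 2) / 2) * Vσ + √3 * n * (l ^ 2 + m ^ 2) * Vπ

/-- `E_{xy,xy} = 3l²m² V_ddσ + (l² + m² − 4l²m²) V_ddπ + (n² + l²m²) V_ddδ`. [cite: SlaterKoster1954, Table I] -/
def xyXY (l m n Vσ Vπ Vδ : ℝ) : ℝ :=
  3 * l ^ 2 * m ^ 2 * Vσ + (l ^ 2 + m ^ 2 - 4 * l ^ 2 * m ^ 2) * Vπ + (n ^ 2 + l ^ 2 * m ^ 2) * Vδ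

/-- `E_{x²−y²,x²−y²} = ¾(l² − m²)² V_ddσ + [l² + m² − (l² − m²)²] V_ddπ + [n² + ¼(l² − m²)²] V_ddδ`.
[cite: SlaterKoster1954, Table I] -/
def x2y2X2Y2 (l m n Vσ Vπ Vδ : ℝ) : ℝ :=
  3 / 4 * (l ^ 2 - m ^ 2) ^ 2 * Vσ + (l ^ 2 + m ^ 2 - (l ^ 2 - m ^ 2) ^ 2) * Vπ
    + (n ^ 2 + (l ^ 2 - m ^ 2) ^ 2 / 4) * Vδ

/-- `E_{3z²−r²,3z²−r²} = [n² − ½(l² + m²)]² V_ddσ + 3n²(l² + m²) V_ddπ + ¾(l² + m²)² V_ddδ`.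
[cite: SlaterKoster1954, Table I] -/
def z2Z2 (l m n Vσ Vπ Vδ : ℝ) : ℝ :=
  (n ^ 2 - (l ^ 2 + m ^ 2) / 2) ^ 2 * Vσ + 3 * n ^ 2 * (l ^ 2 + m ^ 2) * Vπ + 3 / 4 * (l ^ 2 + m ^ 2) ^ 2 * Vδ

/-- `E_{x²−y²,3z²−r²} = (√3/2)(l² − m²)[n² − ½(l² + m²)] V_ddσ + √3 n²(m² − l²) V_ddπ + (√3/4)(1 + n²)(l² − m²) V_ddδ`.
[cite: SlaterKoster1954, Table I] -/
def x2y2Z2 (l m n Vσ Vπ Vδ : ℝ) : ℝ :=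
  √3 / 2 * (l ^ 2 - m ^ 2) * (n ^ 2 - (l ^ 2 + m ^ 2) / 2) * Vσ + √3 * n ^ 2 * (m ^ 2 - l ^ 2) * Vπ
    + √3 / 4 * (1 + n ^ 2) * (l ^ 2 - m ^ 2) * Vδ

/-- «Other matrix elements are found by permuting indices»: `E_{y,3z²−r²}(l,m,n) = E_{x,3z²−r²}(m,l,n)`.
[cite: SlaterKoster1954, Table I] -/
theorem yZ2_eq_xZ2_swap (l m n Vσ Vπ : ℝ) : yZ2 l m n Vσ Vπ = xZ2 m l n Vσ Vπ := by
  simp only [yZ2, xZ2]; ring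

/-- `x ↔ y` flips the sign of `x² − y²`: `E_{y,x²−y²}(l,m,n) = −E_{x,x²−y²}(m,l,n)`.
[cite: SlaterKoster1954, Table I] -/
theorem yX2Y2_eq_neg_xX2Y2_swap (l m Vσ Vπ : ℝ) : yX2Y2 l m Vσ Vπ = -xX2Y2 m l Vσ Vπ := by
  simp only [yX2Y2, xX2Y2]; ring

/-- Vector parity: reversing the bond along `x` flips `E_{x,x²−y²}` … [cite: SlaterKoster1954, Table I] -/
theorem xX2Y2_neg (l m Vσ Vπ : ℝ) : xX2Y2 (-l) m Vσ Vπ = -xX2Y2 l m Vσ Vπ := by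
  simp only [xX2Y2]; ring

/-- … and leaves `E_{z,x²−y²}` unchanged (this parity is what §5's sign structure rests on).
[cite: SlaterKoster1954, Table I] -/
theorem zX2Y2_neg (l m n Vσ Vπ : ℝ) : zX2Y2 (-l) m n Vσ Vπ = zX2Y2 l m n Vσ Vπ := by
  simp only [zX2Y2]; ring

/-! ## 2. The `p`-shell closure identities (consistency of the transcription; need `l² + m² + n² = 1`) -/

/-- The three `p–d_{x²−y²}` elements as a vector over `(p_x, p_y, p_z)`. [cite: SlaterKoster1954, Table I] -/
def pdX2Y2 (l m n Vσ Vπ : ℝ) : Fin 3 → ℝ := ![xX2Y2 l m Vσ Vπ, yX2Y2 l m Vσ Vπ, zX2Y2 l m n Vσ Vπ]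

/-- The three `p–d_{3z²−r²}` elements as a vector over `(p_x, p_y, p_z)`. [cite: SlaterKoster1954, Table I] -/
def pdZ2 (l m n Vσ Vπ : ℝ) : Fin 3 → ℝ := ![xZ2 l m n Vσ Vπ, yZ2 l m n Vσ Vπ, zZ2 l m n Vσ Vπ]

/-- The `π`-part direction of the `p–d_{x²−y²}` coupling: `(l(1−l²+m²), −m(1+l²−m²), −n(l²−m²))`
(read off the `V_pdπ` terms of the table). [cite: SlaterKoster1954, Table I] -/
def piX2Y2 (l m n : ℝ) : Fin 3 → ℝ := ![l * (1 - l ^ 2 + m ^ 2), -(m * (1 + l ^ 2 - m ^ 2)), -(n * (l ^ 2 - m ^ 2))]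

/-- The `π`-part direction of the `p–d_{3z²−r²}` coupling: `√3 (−l n², −m n², n(l²+m²))` (read off the
`V_pdπ` terms of the table). [cite: SlaterKoster1954, Table I] -/
def piZ2 (l m n : ℝ) : Fin 3 → ℝ := ![-(√3 * l * n ^ 2), -(√3 * m * n ^ 2), √3 * n * (l ^ 2 + m ^ 2)]

/-- **σ/π decomposition** of the `p–d_{x²−y²}` row: bond direction times the `σ`-amplitude
`(√3/2)(l²−m²)V_pdσ`, plus `V_pdπ` times the `π` vector (an identity of polynomials, no normalisation
needed). [cite: SlaterKoster1954, Table I] -/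
theorem pdX2Y2_eq (l m n Vσ Vπ : ℝ) :
    pdX2Y2 l m n Vσ Vπ = (sX2Y2 l m Vσ) • ![l, m, n] + Vπ • piX2Y2 l m n := by
  ext i; fin_cases i <;> simp [pdX2Y2, piX2Y2, sX2Y2, xX2Y2, yX2Y2, zX2Y2, smul_eq_mul] <;> ring

/-- **σ/π decomposition** of the `p–d_{3z²−r²}` row. [cite: SlaterKoster1954, Table I] -/
theorem pdZ2_eq (l m n Vσ Vπ : ℝ) :
    pdZ2 l m n Vσ Vπ = (sZ2 l m n Vσ) • ![l, m, n] + Vπ • piZ2 l m n := by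
  ext i; fin_cases i <;> simp [pdZ2, piZ2, sZ2, xZ2, yZ2, zZ2, smul_eq_mul] <;> ring

/-- The `π` vector of `d_{x²−y²}` is orthogonal to the bond for unit direction cosines (the `V_pdπ`
terms of the table carry no `σ` component). [cite: SlaterKoster1954, Table I] -/
theorem dir_dotProduct_piX2Y2 {l m n : ℝ} (h : l ^ 2 + m ^ 2 + n ^ 2 = 1) :
    ![l, m, n] ⬝ᵥ piX2Y2 l m n = 0 := by
  simp only [piX2Y2, vec3_dotProduct, cons_val_zero, cons_val_one, cons_val_two, head_cons, tail_cons]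
  linear_combination (m ^ 2 - l ^ 2) * h

/-- The `π` vector of `d_{3z²−r²}` is orthogonal to the bond (identically). [cite: SlaterKoster1954, Table I] -/
theorem dir_dotProduct_piZ2 (l m n : ℝ) : ![l, m, n] ⬝ᵥ piZ2 l m n = 0 := by
  simp only [piZ2, vec3_dotProduct, cons_val_zero, cons_val_one, cons_val_two, head_cons, tail_cons]
  ring

/-- The `σ` content of the `p–d_{x²−y²}` row: projecting on the bond returns `(√3/2)(l²−m²)V_pdσ`.
[cite: SlaterKoster1954, Table I] -/
theorem dir_dotProduct_pdX2Y2 {l m n : ℝ} (h : l ^ 2 + m ^ 2 + n ^ 2 = 1) (Vσ Vπ : ℝ) :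
    ![l, m, n] ⬝ᵥ pdX2Y2 l m n Vσ Vπ = sX2Y2 l m Vσ := by
  simp only [pdX2Y2, sX2Y2, xX2Y2, yX2Y2, zX2Y2, vec3_dotProduct, cons_val_zero, cons_val_one,
    cons_val_two, head_cons, tail_cons]
  linear_combination ((-1/2) * m ^ 2 * Vσ * √3 + (1/2) * l ^ 2 * Vσ * √3 + m ^ 2 * Vπ - l ^ 2 * Vπ) * h

/-- The `σ` content of the `p–d_{3z²−r²}` row: `[n² − ½(l²+m²)]V_pdσ`. [cite: SlaterKoster1954, Table I] -/
theorem dir_dotProduct_pdZ2 {l m n : ℝ} (h : l ^ 2 + m ^ 2 + n ^ 2 = 1) (Vσ Vπ : ℝ) :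
    ![l, m, n] ⬝ᵥ pdZ2 l m n Vσ Vπ = sZ2 l m n Vσ := by
  simp only [pdZ2, sZ2, xZ2, yZ2, zZ2, vec3_dotProduct, cons_val_zero, cons_val_one, cons_val_two,
    head_cons, tail_cons]
  linear_combination (n ^ 2 * Vσ + (-1/2) * m ^ 2 * Vσ + (-1/2) * l ^ 2 * Vσ) * h

/-- **Closure `x²−y²`**: summing the squared `p–d_{x²−y²}` elements over a complete `p` shell gives the
`d_{x²−y²}–d_{x²−y²}` row with `V_ddσ ↦ V_pdσ²`, `V_ddπ ↦ V_pdπ²`, `V_ddδ ↦ 0` (the `δ` channel is not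
reachable through a `p` orbital). [cite: SlaterKoster1954, Table I] -/
theorem pdX2Y2_dotProduct_self {l m n : ℝ} (h : l ^ 2 + m ^ 2 + n ^ 2 = 1) (Vσ Vπ : ℝ) :
    pdX2Y2 l m n Vσ Vπ ⬝ᵥ pdX2Y2 l m n Vσ Vπ = x2y2X2Y2 l m n (Vσ ^ 2) (Vπ ^ 2) 0 := by
  have h3 : √3 ^ 2 = (3 : ℝ) := Real.sq_sqrt (by norm_num)
  simp only [pdX2Y2, x2y2X2Y2, xX2Y2, yX2Y2, zX2Y2, vec3_dotProduct, cons_val_zero, cons_val_one,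
    cons_val_two, head_cons, tail_cons]
  linear_combination ((1/4) * m ^ 4 * Vσ ^ 2 * √3 ^ 2 + (-1/2) * l ^ 2 * m ^ 2 * Vσ ^ 2 * √3 ^ 2
    + (1/4) * l ^ 4 * Vσ ^ 2 * √3 ^ 2 - m ^ 4 * Vσ * Vπ * √3 + 2 * l ^ 2 * m ^ 2 * Vσ * Vπ * √3
    - l ^ 4 * Vσ * Vπ * √3 + m ^ 4 * Vπ ^ 2 - 2 * l ^ 2 * m ^ 2 * Vπ ^ 2 + l ^ 4 * Vπ ^ 2) * h
    + ((1/4) * m ^ 4 * Vσ ^ 2 + (-1/2) * l ^ 2 * m ^ 2 * Vσ ^ 2 + (1/4) * l ^ 4 * Vσ ^ 2) * h3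

/-- **Closure `3z²−r²`**: `Σ_p E_{p,3z²−r²}² = E_{3z²−r²,3z²−r²}(V_pdσ², V_pdπ², 0)`.
[cite: SlaterKoster1954, Table I] -/
theorem pdZ2_dotProduct_self {l m n : ℝ} (h : l ^ 2 + m ^ 2 + n ^ 2 = 1) (Vσ Vπ : ℝ) :
    pdZ2 l m n Vσ Vπ ⬝ᵥ pdZ2 l m n Vσ Vπ = z2Z2 l m n (Vσ ^ 2) (Vπ ^ 2) 0 := by
  have h3 : √3 ^ 2 = (3 : ℝ) := Real.sq_sqrt (by norm_num)
  simp only [pdZ2, z2Z2, xZ2, yZ2, zZ2, vec3_dotProduct, cons_val_zero, cons_val_one, cons_val_two,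
    head_cons, tail_cons]
  linear_combination (m ^ 2 * n ^ 2 * Vπ ^ 2 * √3 ^ 2 + l ^ 2 * n ^ 2 * Vπ ^ 2 * √3 ^ 2
    + n ^ 4 * Vσ ^ 2 - m ^ 2 * n ^ 2 * Vσ ^ 2 + (1/4) * m ^ 4 * Vσ ^ 2 - l ^ 2 * n ^ 2 * Vσ ^ 2
    + (1/2) * l ^ 2 * m ^ 2 * Vσ ^ 2 + (1/4) * l ^ 4 * Vσ ^ 2) * h
    + (m ^ 2 * n ^ 2 * Vπ ^ 2 + l ^ 2 * n ^ 2 * Vπ ^ 2) * h3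

/-- **Closure, mixed `e_g`**: `Σ_p E_{p,x²−y²} E_{p,3z²−r²} = E_{x²−y²,3z²−r²}(V_pdσ², V_pdπ², 0)`.
[cite: SlaterKoster1954, Table I] -/
theorem pdX2Y2_dotProduct_pdZ2 {l m n : ℝ} (h : l ^ 2 + m ^ 2 + n ^ 2 = 1) (Vσ Vπ : ℝ) :
    pdX2Y2 l m n Vσ Vπ ⬝ᵥ pdZ2 l m n Vσ Vπ = x2y2Z2 l m n (Vσ ^ 2) (Vπ ^ 2) 0 := by
  simp only [pdX2Y2, pdZ2, x2y2Z2, xX2Y2, yX2Y2, zX2Y2, xZ2, yZ2, zZ2, vec3_dotProduct,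
    cons_val_zero, cons_val_one, cons_val_two, head_cons, tail_cons]
  linear_combination ((-1/2) * m ^ 2 * n ^ 2 * Vσ ^ 2 * √3 + (1/4) * m ^ 4 * Vσ ^ 2 * √3
    + (1/2) * l ^ 2 * n ^ 2 * Vσ ^ 2 * √3 + (-1/4) * l ^ 4 * Vσ ^ 2 * √3 + m ^ 2 * n ^ 2 * Vσ * Vπ
    + (-1/2) * m ^ 4 * Vσ * Vπ - l ^ 2 * n ^ 2 * Vσ * Vπ + (1/2) * l ^ 4 * Vσ * Vπ) * h

/-- **Closure `xy`** (a `t_{2g}` row; `E_{y,xy}` and `E_{z,xy}` by permutation):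
`Σ_p E_{p,xy}² = E_{xy,xy}(V_pdσ², V_pdπ², 0)`. [cite: SlaterKoster1954, Table I] -/
theorem pdXY_sum_sq {l m n : ℝ} (h : l ^ 2 + m ^ 2 + n ^ 2 = 1) (Vσ Vπ : ℝ) :
    xXY l m Vσ Vπ ^ 2 + xXY m l Vσ Vπ ^ 2 + xYZ l m n Vσ Vπ ^ 2 = xyXY l m n (Vσ ^ 2) (Vπ ^ 2) 0 := by
  have h3 : √3 ^ 2 = (3 : ℝ) := Real.sq_sqrt (by norm_num)
  simp only [xXY, xYZ, xyXY]
  linear_combination (l ^ 2 * m ^ 2 * Vσ ^ 2 * √3 ^ 2 - 4 * l ^ 2 * m ^ 2 * Vσ * Vπ * √3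
    + 4 * l ^ 2 * m ^ 2 * Vπ ^ 2) * h + (l ^ 2 * m ^ 2 * Vσ ^ 2) * h3

/-! ## 3. Straight bonds: the `CuO₂` / `NiO₂` plane and the apical oxygen -/

/-- Planar oxygen on the `±x̂` bond (`l = ±1`, `m = n = 0`): `E_{x,x²−y²} = ±(√3/2)V_pdσ`, no `π` part.
[cite: Harrison1999, §18-4 Eq. (18-19)] -/
theorem xX2Y2_xbond {l : ℝ} (hl : l ^ 2 = 1) (Vσ Vπ : ℝ) : xX2Y2 l 0 Vσ Vπ = √3 / 2 * l * Vσ := by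
  simp only [xX2Y2]
  linear_combination ((1/2) * l * Vσ * √3 - l * Vπ) * hl

/-- … while `p_y` and `p_z` on that oxygen do not couple to `d_{x²−y²}` at all. [cite: SlaterKoster1954, Table I] -/
theorem yX2Y2_xbond (l Vσ Vπ : ℝ) : yX2Y2 l 0 Vσ Vπ = 0 ∧ zX2Y2 l 0 0 Vσ Vπ = 0 := by
  simp only [yX2Y2, zX2Y2]; constructor <;> ring

/-- Planar oxygen on the `±ŷ` bond (`m = ±1`): `E_{y,x²−y²} = ∓(√3/2)V_pdσ` — the OPPOSITE sign to the
`x` bond: the `d`-wave phase pattern of the three-band model. [cite: SlaterKoster1954, Table I] -/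
theorem yX2Y2_ybond {m : ℝ} (hm : m ^ 2 = 1) (Vσ Vπ : ℝ) : yX2Y2 0 m Vσ Vπ = -(√3 / 2 * m * Vσ) := by
  simp only [yX2Y2]
  linear_combination ((-1/2) * m * Vσ * √3 + m * Vπ) * hm

/-- `d_{3z²−r²}` to the `±x̂` oxygen: `E_{x,3z²−r²} = ∓½V_pdσ`. [cite: Harrison1999, Table 15-2] -/
theorem xZ2_xbond {l : ℝ} (hl : l ^ 2 = 1) (Vσ Vπ : ℝ) : xZ2 l 0 0 Vσ Vπ = -(l / 2 * Vσ) := by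
  simp only [xZ2]
  linear_combination ((-1/2) * l * Vσ) * hl

/-- `d_{3z²−r²}` to the `±ŷ` oxygen: `E_{y,3z²−r²} = ∓½V_pdσ` — the SAME sign as the `x` bond
(`s`-wave pattern). [cite: Harrison1999, Table 15-2] -/
theorem yZ2_ybond {m : ℝ} (hm : m ^ 2 = 1) (Vσ Vπ : ℝ) : yZ2 0 m 0 Vσ Vπ = -(m / 2 * Vσ) := by
  simp only [yZ2]
  linear_combination ((-1/2) * m * Vσ) * hm

/-- **The `1/√3` rule with its sign**: on an `x` bond `E_{x,x²−y²} = −√3·E_{x,3z²−r²}` …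
[cite: Harrison1999, Table 15-2] -/
theorem xX2Y2_eq_xZ2_xbond {l : ℝ} (hl : l ^ 2 = 1) (Vσ Vπ : ℝ) :
    xX2Y2 l 0 Vσ Vπ = -(√3 * xZ2 l 0 0 Vσ Vπ) := by
  simp only [xX2Y2, xZ2]
  linear_combination (-(l * Vπ)) * hl

/-- … and on a `y` bond `E_{y,x²−y²} = +√3·E_{y,3z²−r²}`. [cite: Harrison1999, Table 15-2] -/
theorem yX2Y2_eq_yZ2_ybond {m : ℝ} (hm : m ^ 2 = 1) (Vσ Vπ : ℝ) :
    yX2Y2 0 m Vσ Vπ = √3 * yZ2 0 m 0 Vσ Vπ := by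
  simp only [yX2Y2, yZ2]
  linear_combination (m * Vπ) * hm

/-- Apical oxygen (`n = ±1`): `p_z` couples to `d_{3z²−r²}` with `±V_pdσ` and to `d_{x²−y²}` NOT AT
ALL; `p_x`, `p_y` on the apical site couple to neither `e_g` orbital. [cite: SlaterKoster1954, Table I] -/
theorem apical {n : ℝ} (hn : n ^ 2 = 1) (Vσ Vπ : ℝ) :
    zZ2 0 0 n Vσ Vπ = n * Vσ ∧ zX2Y2 0 0 n Vσ Vπ = 0 ∧ xZ2 0 0 n Vσ Vπ = 0 ∧ xX2Y2 0 0 Vσ Vπ = 0 := by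
  simp only [zZ2, zX2Y2, xZ2, xX2Y2]
  refine ⟨?_, by ring, by ring, by ring⟩
  linear_combination (n * Vσ) * hn

/-- The three-band `t_pd := E_{x,x²−y²}` on the `+x̂` bond. [cite: Harrison1999, §18-4 Eq. (18-19)] -/
def tpd (Vσ Vπ : ℝ) : ℝ := xX2Y2 1 0 Vσ Vπ

/-- `t_pd = (√3/2)V_pdσ`. [cite: Harrison1999, §18-4 Eq. (18-19)] -/
theorem tpd_eq (Vσ Vπ : ℝ) : tpd Vσ Vπ = √3 / 2 * Vσ := by
  rw [tpd, xX2Y2_xbond (by norm_num)]; ring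

/-- `4 t_pd² = 3 V_pdσ²`: the «3» under the square root of Harrison's `CuO₂` band
`ε_k = ε_d − V_pdσ √(3(sin²k_x d + sin²k_y d))`. [cite: Harrison1999, §18-4 Eq. (18-19)] -/
theorem four_tpd_sq (Vσ Vπ : ℝ) : 4 * tpd Vσ Vπ ^ 2 = 3 * Vσ ^ 2 := by
  have h3 : √3 ^ 2 = (3 : ℝ) := Real.sq_sqrt (by norm_num)
  rw [tpd_eq]
  linear_combination (Vσ ^ 2) * h3

/-- Oxygen–oxygen contact in the plane, direction `(cos ψ, sin ψ, 0)`: two parallel `p_x` orbitals couple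
by `cos²ψ V_ppσ + sin²ψ V_ppπ`, and `p_x` with `p_y` by `½ sin 2ψ (V_ppσ − V_ppπ)`.
[cite: SlaterKoster1954, Table I] -/
theorem pp_planar (ψ Vσ Vπ : ℝ) :
    xX (cos ψ) Vσ Vπ = cos ψ ^ 2 * Vσ + sin ψ ^ 2 * Vπ ∧
      xY (cos ψ) (sin ψ) Vσ Vπ = sin (2 * ψ) / 2 * (Vσ - Vπ) := by
  constructor
  · simp only [xX]; linear_combination (-Vπ) * sin_sq_add_cos_sq ψ
  · simp only [xY]; rw [sin_two_mul]; ring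

/-- The 45° O–O contact of the `CuO₂` plane (`|lm| = ½`, e.g. `(l,m) = (∓1/√2, ±1/√2)`):
`|E_{x,y}| = ½|V_ppσ − V_ppπ|` — the three-band `t_pp`. [cite: SlaterKoster1954, Table I] -/
theorem abs_xY_diag {l m : ℝ} (hlm : |l * m| = 1 / 2) (Vσ Vπ : ℝ) :
    |xY l m Vσ Vπ| = |Vσ - Vπ| / 2 := by
  have : xY l m Vσ Vπ = (l * m) * (Vσ - Vπ) := by simp only [xY]; ring
  rw [this, abs_mul, hlm]; ring

/-! ## 4. The buckled planar bridge M–O–M, LOCAL (co-rotating) frames: Normand–Kampf's factor derived -/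

/-- Unit vector from the left metal to the lifted oxygen: `(cos φ, 0, sin φ)`. [cite: NormandKampf2001, p. 2] -/
def dirL (φ : ℝ) : Fin 3 → ℝ := ![cos φ, 0, sin φ]

/-- Unit vector from the right metal to the same oxygen: `(−cos φ, 0, sin φ)`; the M–O–M angle is
`θ = π − 2φ`. [cite: NormandKampf2001, p. 2] -/
def dirR (φ : ℝ) : Fin 3 → ℝ := ![-cos φ, 0, sin φ]

/-- `ê_L · ê_R = −cos 2φ = cos(π − 2φ) = cos θ`. [cite: NormandKampf2001, Eq. (1)] -/
theorem dirL_dotProduct_dirR (φ : ℝ) : dirL φ ⬝ᵥ dirR φ = cos (π - 2 * φ) := by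
  simp only [dirL, dirR, vec3_dotProduct, cons_val_zero, cons_val_one, cons_val_two, head_cons,
    tail_cons, cos_pi_sub, cos_two_mul]
  linear_combination sin_sq_add_cos_sq φ

/-- LOCAL-FRAME second-order numerator through the shared oxygen `p` shell: each `d_{x²−y²}` sees the
oxygen on its own lobe axis, so couples ONLY to the `p` orbital along its own bond with the straight
value `(√3/2)V_pdσ` (§3: no `π` part); the `p` shell being complete, the path is
`((√3/2)V_pdσ ê_L) · ((√3/2)V_pdσ ê_R)`. [cite: NormandKampf2001, Eq. (1)] -/
def localPath (φ Vσ : ℝ) : ℝ := ((√3 / 2 * Vσ) • dirL φ) ⬝ᵥ ((√3 / 2 * Vσ) • dirR φ)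

/-- `localPath φ = ¾V_pdσ² · cos(π − 2φ)`; `V_pdπ` does not enter. [cite: NormandKampf2001, Eq. (1)] -/
theorem localPath_eq (φ Vσ : ℝ) : localPath φ Vσ = 3 / 4 * Vσ ^ 2 * cos (π - 2 * φ) := by
  have h3 : √3 ^ 2 = (3 : ℝ) := Real.sq_sqrt (by norm_num)
  rw [localPath, smul_dotProduct, dotProduct_smul, dirL_dotProduct_dirR, smul_eq_mul, smul_eq_mul]
  linear_combination (1/4 * Vσ ^ 2 * cos (π - 2 * φ)) * h3

/-- Straight bridge: `localPath 0 = −¾V_pdσ²`. [cite: NormandKampf2001, Eq. (1)] -/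
theorem localPath_zero (Vσ : ℝ) : localPath 0 Vσ = -(3 / 4 * Vσ ^ 2) := by
  rw [localPath_eq, mul_zero, sub_zero, cos_pi]; ring

/-- **Normand–Kampf's Eq. (1) derived**: `|t(φ)|/|t(0)| = |cos(π − 2φ)| = lttHoppingFactor φ` for
every `φ` and every `V_pdσ ≠ 0`. [cite: NormandKampf2001, Eq. (1)] -/
theorem abs_localPath_div (φ : ℝ) {Vσ : ℝ} (hV : Vσ ≠ 0) :
    |localPath φ Vσ| / |localPath 0 Vσ| = lttHoppingFactor φ := by
  have hne : localPath 0 Vσ ≠ 0 := by rw [localPath_zero]; exact neg_ne_zero.mpr (by positivity)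
  rw [div_eq_iff (abs_ne_zero.mpr hne), localPath_eq, localPath_zero, lttHoppingFactor_def, abs_neg,
    ← abs_mul]
  congr 1; ring

/-- Hence the exchange factor (`J ∝ t²`): `(t(φ)/t(0))² = lttExchangeFactor φ = cos²(π − 2φ)`.
[cite: NormandKampf2001, Eq. (1)] -/
theorem localPath_div_sq (φ : ℝ) {Vσ : ℝ} (hV : Vσ ≠ 0) :
    (localPath φ Vσ / localPath 0 Vσ) ^ 2 = lttExchangeFactor φ := by
  rw [lttExchangeFactor_eq_sq, ← abs_localPath_div φ hV, ← abs_div, sq_abs]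

/-! ## 5. The same bridge in the GLOBAL frame (`d` orbitals pinned to the crystal axes) -/

/-- GLOBAL-FRAME second-order numerator: `Σ_p E_{p,x²−y²}(ê_L) E_{p,x²−y²}(ê_R)` with the `d_{x²−y²}`
orbitals of both metals kept along the crystal axes (now off the lobe axis, so `V_pdπ` enters).
[cite: SlaterKoster1954, Table I] -/
def globalPath (φ Vσ Vπ : ℝ) : ℝ :=
  pdX2Y2 (cos φ) 0 (sin φ) Vσ Vπ ⬝ᵥ pdX2Y2 (-cos φ) 0 (sin φ) Vσ Vπ

/-- Closed form: `globalPath = −[¾c⁴(c²−s²)V_σ² + 2√3 c⁴s² V_σV_π − c²s²(c²−s²)V_π²]`, `c = cos φ`,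
`s = sin φ`. [cite: SlaterKoster1954, Table I] -/
theorem globalPath_eq (φ Vσ Vπ : ℝ) :
    globalPath φ Vσ Vπ = -(3 / 4 * cos φ ^ 4 * (cos φ ^ 2 - sin φ ^ 2) * Vσ ^ 2
      + 2 * √3 * cos φ ^ 4 * sin φ ^ 2 * Vσ * Vπ - cos φ ^ 2 * sin φ ^ 2 * (cos φ ^ 2 - sin φ ^ 2) * Vπ ^ 2) := by
  have h3 : √3 ^ 2 = (3 : ℝ) := Real.sq_sqrt (by norm_num)
  have hsc := sin_sq_add_cos_sq φ
  simp only [globalPath, pdX2Y2, xX2Y2, yX2Y2, zX2Y2, vec3_dotProduct, cons_val_zero, cons_val_one,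
    cons_val_two, head_cons, tail_cons]
  linear_combination ((1/4) * Vσ ^ 2 * √3 ^ 2 * cos φ ^ 4 + Vσ * Vπ * √3 * cos φ ^ 4
    + Vπ ^ 2 * cos φ ^ 2 * sin φ ^ 2 - Vπ ^ 2 * cos φ ^ 4 + (-3/4) * Vσ ^ 2 * cos φ ^ 4
    + Vπ ^ 2 * cos φ ^ 2) * hsc + ((-1/2) * Vσ ^ 2 * cos φ ^ 6 + (1/4) * Vσ ^ 2 * cos φ ^ 4) * h3

/-- Straight bridge: `globalPath 0 = −¾V_pdσ²` whatever `V_pdπ`. [cite: SlaterKoster1954, Table I] -/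
theorem globalPath_zero (Vσ Vπ : ℝ) : globalPath 0 Vσ Vπ = -(3 / 4 * Vσ ^ 2) := by
  rw [globalPath_eq, cos_zero, sin_zero]; ring

/-- The global-frame `σ`-only buckling factor `cos⁴φ · cos 2φ` (from the `V_pdσ` terms of the table at
`(±cos φ, 0, sin φ)`). [cite: SlaterKoster1954, Table I] -/
def globalSigmaFactor (φ : ℝ) : ℝ := cos φ ^ 4 * cos (2 * φ)

/-- `σ`-only: `globalPath φ V_σ 0 = (cos⁴φ cos 2φ) · globalPath 0 V_σ 0`. [cite: SlaterKoster1954, Table I] -/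
theorem globalPath_sigma (φ Vσ : ℝ) : globalPath φ Vσ 0 = globalSigmaFactor φ * globalPath 0 Vσ 0 := by
  rw [globalPath_eq, globalPath_zero, globalSigmaFactor, cos_two_mul]
  linear_combination (3/4 * cos φ ^ 4 * Vσ ^ 2) * sin_sq_add_cos_sq φ

/-- With `V_pdπ = r V_pdσ`: `globalPath φ = R(φ,r) · globalPath 0`,
`R = c⁴cos 2φ + (8/√3)·r·c⁴s² − (4/3)r² c²s² cos 2φ` (written with `√3`: `(8/√3) = 8√3/9`).
[cite: SlaterKoster1954, Table I] -/
theorem globalPath_ratio (φ Vσ r : ℝ) :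
    globalPath φ Vσ (r * Vσ) = (cos φ ^ 4 * (cos φ ^ 2 - sin φ ^ 2) + 8 / 3 * √3 * r * cos φ ^ 4 * sin φ ^ 2
      - 4 / 3 * r ^ 2 * cos φ ^ 2 * sin φ ^ 2 * (cos φ ^ 2 - sin φ ^ 2)) * globalPath 0 Vσ (r * Vσ) := by
  rw [globalPath_eq, globalPath_zero]; ring

/-- **Frame lever, exact**: `globalSigmaFactor φ = cos⁴φ × lttHoppingFactor φ` for `0 ≤ φ ≤ π/4`.
[cite: NormandKampf2001, Eq. (1)] -/
theorem globalSigmaFactor_eq_mul_ltt {φ : ℝ} (h0 : 0 ≤ φ) (h1 : φ ≤ π / 4) :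
    globalSigmaFactor φ = cos φ ^ 4 * lttHoppingFactor φ := by
  rw [globalSigmaFactor, lttHoppingFactor_eq_cos h0 h1]

/-- Hence `globalSigmaFactor φ ≤ lttHoppingFactor φ` on `0 ≤ φ ≤ π/4` (the global frame buckles MORE).
[cite: NormandKampf2001, Eq. (1)] -/
theorem globalSigmaFactor_le_ltt {φ : ℝ} (h0 : 0 ≤ φ) (h1 : φ ≤ π / 4) :
    globalSigmaFactor φ ≤ lttHoppingFactor φ := by
  rw [globalSigmaFactor_eq_mul_ltt h0 h1]
  have hc2 : cos φ ^ 2 ≤ 1 := cos_sq_le_one φ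
  have hc0 : 0 ≤ cos φ ^ 2 := sq_nonneg _
  have hc : cos φ ^ 4 ≤ 1 := by nlinarith
  have hF : 0 ≤ lttHoppingFactor φ := by rw [lttHoppingFactor_def]; exact abs_nonneg _
  nlinarith

/-- The global-frame `σ`-only anisotropy `1 − cos⁴φ cos 2φ = 4s² − 5s⁴ + 2s⁶`, `s = sin φ` (all `φ`;
compare Normand–Kampf's `1 − |cos(π − 2φ)| = 2s²`). [cite: NormandKampf2001, Eq. (1)] -/
theorem one_sub_globalSigmaFactor (φ : ℝ) :
    1 - globalSigmaFactor φ = 4 * sin φ ^ 2 - 5 * sin φ ^ 4 + 2 * sin φ ^ 6 := by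
  rw [globalSigmaFactor, cos_two_mul]
  linear_combination (-2 * sin φ ^ 4 + 2 * cos φ ^ 2 * sin φ ^ 2 - 2 * cos φ ^ 4 + 3 * sin φ ^ 2
    - cos φ ^ 2 - 1) * sin_sq_add_cos_sq φ

/-- In terms of the local anisotropy `ε = lttHoppingAnisotropy φ = 2 sin²φ` (`0 ≤ φ ≤ π/4`):
`1 − globalSigmaFactor φ = 2ε − (5/4)ε² + ¼ε³`. [cite: NormandKampf2001, p. 2] -/
theorem one_sub_globalSigmaFactor_eq_ltt {φ : ℝ} (h0 : 0 ≤ φ) (h1 : φ ≤ π / 4) :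
    1 - globalSigmaFactor φ = 2 * lttHoppingAnisotropy φ - 5 / 4 * lttHoppingAnisotropy φ ^ 2
      + 1 / 4 * lttHoppingAnisotropy φ ^ 3 := by
  rw [one_sub_globalSigmaFactor, lttHoppingAnisotropy_eq h0 h1]; ring

/-- Two-sided comparison with the local (Normand–Kampf) anisotropy on `0 ≤ φ ≤ π/4`:
`2ε − (5/4)ε² ≤ 1 − globalSigmaFactor φ ≤ 2ε`. [cite: NormandKampf2001, p. 2] -/
theorem one_sub_globalSigmaFactor_bounds {φ : ℝ} (h0 : 0 ≤ φ) (h1 : φ ≤ π / 4) :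
    2 * lttHoppingAnisotropy φ - 5 / 4 * lttHoppingAnisotropy φ ^ 2 ≤ 1 - globalSigmaFactor φ ∧
      1 - globalSigmaFactor φ ≤ 2 * lttHoppingAnisotropy φ := by
  rw [one_sub_globalSigmaFactor_eq_ltt h0 h1]
  obtain ⟨he0, he1⟩ := lttHoppingAnisotropy_mem_Icc φ
  constructor <;> nlinarith [pow_nonneg he0 3, pow_nonneg he0 2]

/-- **Instance at the printed maximal tilt `Φ = 5° = π/36`**: global-frame `σ`-only hopping anisotropy
`∈ (0.0299, 0.0306)` (local frame: `(0.0151, 0.0153)`, `lttHoppingAnisotropy_five_deg`).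
[cite: NormandKampf2001, p. 2] -/
theorem one_sub_globalSigmaFactor_five_deg :
    (0.0299 : ℝ) < 1 - globalSigmaFactor (π / 36) ∧ 1 - globalSigmaFactor (π / 36) < 0.0306 := by
  have hq : (0 : ℝ) ≤ π / 36 ∧ π / 36 ≤ π / 4 := ⟨by positivity, by linarith [pi_pos]⟩
  obtain ⟨hlo, hhi⟩ := lttHoppingAnisotropy_five_deg
  obtain ⟨hb1, hb2⟩ := one_sub_globalSigmaFactor_bounds hq.1 hq.2
  have hprod : 0 < (lttHoppingAnisotropy (π / 36) - 0.0151) * (0.0153 - lttHoppingAnisotropy (π / 36)) :=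
    mul_pos (sub_pos.mpr hlo) (sub_pos.mpr hhi)
  constructor <;> nlinarith

/-- The `π` channel lowers the factor further for the physical sign `r = V_pdπ/V_pdσ ≤ 0` on
`0 ≤ φ ≤ π/4`: `R(φ,r) ≤ globalSigmaFactor φ`. [cite: Harrison1999, §18-4 Eq. (18-18)] -/
theorem globalRatio_le_sigma {φ r : ℝ} (h0 : 0 ≤ φ) (h1 : φ ≤ π / 4) (hr : r ≤ 0) :
    cos φ ^ 4 * (cos φ ^ 2 - sin φ ^ 2) + 8 / 3 * √3 * r * cos φ ^ 4 * sin φ ^ 2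
      - 4 / 3 * r ^ 2 * cos φ ^ 2 * sin φ ^ 2 * (cos φ ^ 2 - sin φ ^ 2) ≤ globalSigmaFactor φ := by
  have h2 : cos (2 * φ) = cos φ ^ 2 - sin φ ^ 2 := by
    rw [cos_two_mul]; linear_combination sin_sq_add_cos_sq φ
  have hcos2 : 0 ≤ cos φ ^ 2 - sin φ ^ 2 := by
    rw [← h2]
    exact cos_nonneg_of_neg_pi_div_two_le_of_le (by linarith [pi_pos]) (by linarith)
  rw [globalSigmaFactor, h2]
  have hA : 8 / 3 * √3 * r * cos φ ^ 4 * sin φ ^ 2 ≤ 0 := by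
    have : 0 ≤ 8 / 3 * √3 * cos φ ^ 4 * sin φ ^ 2 := by positivity
    nlinarith
  have hB : 0 ≤ 4 / 3 * r ^ 2 * cos φ ^ 2 * sin φ ^ 2 * (cos φ ^ 2 - sin φ ^ 2) := by
    have : 0 ≤ 4 / 3 * r ^ 2 * cos φ ^ 2 * sin φ ^ 2 := by positivity
    exact mul_nonneg this hcos2
  linarith

/-! ## 6. The bent apical bridge `d_{3z²−r²}`–O–`d_{3z²−r²}` (bilayer, M–O_ap–M angle `π − 2φ`) -/

/-- Unit vectors from the lower / upper metal to the sideways-displaced apical oxygen: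
`(sin φ, 0, cos φ)` and `(sin φ, 0, −cos φ)`; their dot product is again `cos(π − 2φ)`, so the
LOCAL-frame factor of the inter-layer `σ` path is the same `|cos θ|` as in §4. [cite: NormandKampf2001, Eq. (1)] -/
theorem apicalDirs_dotProduct (φ : ℝ) : ![sin φ, 0, cos φ] ⬝ᵥ ![sin φ, 0, -cos φ] = cos (π - 2 * φ) := by
  simp only [vec3_dotProduct, cons_val_zero, cons_val_one, cons_val_two, head_cons, tail_cons,
    cos_pi_sub, cos_two_mul]
  linear_combination sin_sq_add_cos_sq φ

/-- GLOBAL-frame second-order numerator of the bent apical bridge: `Σ_p E_{p,3z²−r²}(ê₁)E_{p,3z²−r²}(ê₂)`.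
[cite: SlaterKoster1954, Table I] -/
def apicalPath (φ Vσ Vπ : ℝ) : ℝ :=
  pdZ2 (sin φ) 0 (cos φ) Vσ Vπ ⬝ᵥ pdZ2 (sin φ) 0 (-cos φ) Vσ Vπ

/-- Closed form: `apicalPath = −[(c²−s²)(c²−½s²)² V_σ² + 4√3 c²s²(c²−½s²) V_σV_π − 3c²s²(c²−s²) V_π²]`.
[cite: SlaterKoster1954, Table I] -/
theorem apicalPath_eq (φ Vσ Vπ : ℝ) :
    apicalPath φ Vσ Vπ = -((cos φ ^ 2 - sin φ ^ 2) * (cos φ ^ 2 - sin φ ^ 2 / 2) ^ 2 * Vσ ^ 2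
      + 4 * √3 * cos φ ^ 2 * sin φ ^ 2 * (cos φ ^ 2 - sin φ ^ 2 / 2) * Vσ * Vπ
      - 3 * cos φ ^ 2 * sin φ ^ 2 * (cos φ ^ 2 - sin φ ^ 2) * Vπ ^ 2) := by
  have h3 : √3 ^ 2 = (3 : ℝ) := Real.sq_sqrt (by norm_num)
  have hsc := sin_sq_add_cos_sq φ
  simp only [apicalPath, pdZ2, xZ2, yZ2, zZ2, vec3_dotProduct, cons_val_zero, cons_val_one,
    cons_val_two, head_cons, tail_cons]
  linear_combination (-(Vπ ^ 2 * √3 ^ 2 * cos φ ^ 2 * sin φ ^ 2) + Vπ ^ 2 * √3 ^ 2 * cos φ ^ 4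
    + 3 * Vπ ^ 2 * cos φ ^ 2 * sin φ ^ 2 - 3 * Vπ ^ 2 * cos φ ^ 4) * hsc
    + (Vπ ^ 2 * cos φ ^ 4 * sin φ ^ 2 - Vπ ^ 2 * cos φ ^ 6 - Vπ ^ 2 * cos φ ^ 2 * sin φ ^ 2
    + Vπ ^ 2 * cos φ ^ 4) * h3

/-- Straight apical bridge: `apicalPath 0 = −V_pdσ²`. [cite: SlaterKoster1954, Table I] -/
theorem apicalPath_zero (Vσ Vπ : ℝ) : apicalPath 0 Vσ Vπ = -Vσ ^ 2 := by
  rw [apicalPath_eq, cos_zero, sin_zero]; ring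

/-- `σ`-only global factor of the bent apical bridge: `apicalPath φ V_σ 0 = [cos 2φ (cos²φ − ½sin²φ)²] · apicalPath 0 V_σ 0`.
[cite: SlaterKoster1954, Table I] -/
theorem apicalPath_sigma (φ Vσ : ℝ) :
    apicalPath φ Vσ 0 = (cos (2 * φ) * (cos φ ^ 2 - sin φ ^ 2 / 2) ^ 2) * apicalPath 0 Vσ 0 := by
  rw [apicalPath_eq, apicalPath_zero, cos_two_mul]
  linear_combination ((cos φ ^ 2 - sin φ ^ 2 / 2) ^ 2 * Vσ ^ 2) * sin_sq_add_cos_sq φ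

end SlaterKoster

end Literature.MathematicalPhysics.QuantumLattice

end
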